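import Summits.Ventures.CertifiedQuantumChemistry.Rows.FrozenCoreRelaxationBlocks
import HarnessLib

/-!
# Ventures/CertifiedQuantumChemistry — Rows/FrozenCoreRelaxationHole.lean: the `Q`-condition transports
# along the frozen-core extension of an abstract pair

HONEST FRAMING (verbatim): certified bounds for a stated model Hamiltonian in a stated basis; not a
claim about the real molecule beyond that model.

Seat rdm-B (gen 22), file 3 of the relaxation-level frozen-core set (files 1–2:
`Rows/FrozenCoreRelaxation{Pair,Blocks}.lean` — `frozenOne`, `frozenTwo`, their blocks, `D ⪰ 0`). Here the
two-hole matrix `qMap γ' Γ'` (Mazziotti's `Q`-map, `VariationalRDMRelaxation.lean` eq. (14)) of the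
extended pair is decomposed into three positive pieces,

  `qMap γ' Γ' = E₂ (qMap γ Γ) E₂ᴴ + Σ_{v virtual} F_v (1 − γᵀ) F_vᴴ + ²Q(|rangeF e ∪ K⟩)`

(**`qMap_frozen`**; `F_v = mixedPair e v`; the virtual orbitals are `(rangeF e ∪ K)ᶜ`; `²Q(|T⟩)` = the
two-hole matrix of the occupation vector with the active and frozen orbitals filled, whose closed form
`twoHoleRDM_single` is supported on pairs outside `T`): the active two-hole block, the active-hole ⊗
virtual-hole blocks carrying the ONE-HOLE matrix `¹Q = 1 − γᵀ`, and a state's two-hole matrix. The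
identity is checked block by block in the 16 active / environment index patterns with the block entries of
file 2. Consequence **`posSemidef_qMap_frozen`**: `qMap γ Γ ⪰ 0 ∧ 1 − γᵀ ⪰ 0 ⇒ qMap γ' Γ' ⪰ 0`, and
`posSemidef_qMap_frozen_of_isDQGFeasible`: on the DQG-feasible set with at least two empty active spin
orbitals (`N + 2 ≤ |ι|`, where `IsDQGFeasible.oneHole_posSemidef` of `OnePositivityFromTwoPositivity.lean`
supplies `1 − γᵀ ⪰ 0`) the `Q`-CONDITION TRANSPORTS. Index bookkeeping (`rangeF_cases`, membership simp
forms for `rangeF e ∪ K` and its complement, `star_single_dotProduct_single`) is shared with file 4.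

All PROVED (0 sorry, no definition); abstract programme objects only — no row, no certificate, nothing
about a deposited model. References: D. A. Mazziotti, Adv. Chem. Phys. 134 (2007) ch. 3 §II.B eqs. (12),
(14), (17) [Mazziotti2007RDMChapter]; T. Helgaker, P. Jørgensen, J. Olsen (2000) §12.5.1
[HelgakerJorgensenOlsen2000].
-/

noncomputable section

namespace Summit.Ventures.CertifiedQuantumChemistry

open Matrix Finset
open Literature.MathematicalPhysics.QuantumLattice Literature.MathematicalPhysics.QuantumChemistry JWEmbed
open scoped ComplexOrder

variable {ι ι' : Type*} [LinearOrder ι] [LinearOrder ι'] [Fintype ι] [Fintype ι']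
variable (e : ι ↪o ι') {K : Finset ι'}

/-! ## The `Q`-matrix of the extended pair -/

section Hole

variable (γ : Matrix ι ι ℂ) (Γ : Matrix (ι × ι) (ι × ι) ℂ)

omit [Fintype ι'] in
/-- Every orbital of the big space is an active orbital `e i` or an environment orbital. -/
theorem rangeF_cases (p : ι') : (∃ i, e i = p) ∨ p ∉ rangeF e := by
  by_cases h : p ∈ rangeF e
  · exact Or.inl (mem_rangeF.1 h)
  · exact Or.inr h

omit [Fintype ι'] in
/-- An active orbital lies in `rangeF e ∪ K` (simp form). -/
theorem apply_mem_union_iff (K : Finset ι') (i : ι) : e i ∈ rangeF e ∪ K ↔ True :=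
  iff_true_intro (Finset.mem_union_left _ (mem_rangeF.2 ⟨i, rfl⟩))

omit [Fintype ι'] in
/-- An environment orbital lies in `rangeF e ∪ K` iff it is frozen (simp form). -/
theorem env_mem_union_iff (K : Finset ι') {m : ι'} (hm : m ∉ rangeF e) : m ∈ rangeF e ∪ K ↔ m ∈ K := by
  rw [Finset.mem_union, or_iff_right hm]

/-- The virtual orbitals `(rangeF e ∪ K)ᶜ` are environment orbitals. -/
theorem disjoint_compl_union_rangeF (K : Finset ι') : Disjoint (rangeF e ∪ K)ᶜ (rangeF e) :=
  Finset.disjoint_left.2 fun _ hm hm' => (Finset.mem_compl.1 hm) (Finset.mem_union_left _ hm')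

/-- An environment orbital is virtual iff it is not frozen (simp form). -/
theorem env_mem_compl_union_iff (K : Finset ι') {m : ι'} (hm : m ∉ rangeF e) :
    m ∈ (rangeF e ∪ K)ᶜ ↔ m ∉ K := by
  rw [Finset.mem_compl, env_mem_union_iff e K hm]

/-- An occupation-number vector has unit norm. -/
theorem star_single_dotProduct_single (T : Finset ι') :
    star (Pi.single T (1 : ℂ) : Fock ι') ⬝ᵥ Pi.single T (1 : ℂ) = 1 := by
  rw [dotProduct_single, Pi.star_apply, Pi.single_eq_same, star_one, one_mul]

/-- **The two-hole matrix of an occupation-number vector** `|T⟩` in closed form: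
`²Q(|T⟩)^{ij}_{kl} = [i ∉ T][j ∉ T](δ_ik δ_jl − δ_il δ_jk)` (two holes can only be created outside `T`). -/
theorem twoHoleRDM_single (T : Finset ι') (i j k l : ι') :
    twoHoleRDM (Pi.single T (1 : ℂ)) (i, j) (k, l) =
      if i ∈ T ∨ j ∈ T then 0 else
        ((if i = k then (1 : ℂ) else 0) * (if j = l then 1 else 0) -
          (if i = l then (1 : ℂ) else 0) * (if j = k then 1 else 0)) := by
  rw [twoHoleRDM_apply, star_single_dotProduct_single, oneRDM_single, oneRDM_single, oneRDM_single,
    oneRDM_single, twoRDM_single]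
  by_cases hi : i ∈ T <;> by_cases hj : j ∈ T <;> by_cases h1 : i = k <;> by_cases h2 : j = l <;>
    by_cases h3 : i = l <;> by_cases h4 : j = k <;> simp_all [eq_comm]

/-- **THE `Q`-MATRIX OF THE EXTENDED PAIR** decomposes into three positive pieces:
`qMap γ' Γ' = E₂ (qMap γ Γ) E₂ᴴ + Σ_{v virtual} F_v (1 − γᵀ) F_vᴴ + ²Q(|rangeF e ∪ K⟩)` — the active
two-hole block, the active-hole ⊗ virtual-hole blocks carrying the one-hole matrix `¹Q = 1 − γᵀ`, and
the two-hole matrix of the occupation vector with the active and frozen orbitals filled (supported on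
virtual pairs). An identity of affine maps in `(γ, Γ)`, checked block by block (16 index patterns). -/
theorem qMap_frozen (hK : Disjoint K (rangeF e)) :
    qMap (frozenOne e K γ) (frozenTwo e K γ Γ) =
      embTwo e * qMap γ Γ * (embTwo e)ᴴ +
        ∑ v ∈ (rangeF e ∪ K)ᶜ, mixedPair e v * (1 - γᵀ) * (mixedPair e v)ᴴ +
        twoHoleRDM (Pi.single (rangeF e ∪ K) (1 : ℂ)) := by
  have hV := disjoint_compl_union_rangeF e K
  ext ⟨p₁, p₂⟩ ⟨q₁, q₂⟩
  rw [Matrix.add_apply, Matrix.add_apply]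
  rcases rangeF_cases e p₁ with ⟨i₁, rfl⟩ | hp₁ <;> rcases rangeF_cases e p₂ with ⟨i₂, rfl⟩ | hp₂ <;>
    rcases rangeF_cases e q₁ with ⟨j₁, rfl⟩ | hq₁ <;> rcases rangeF_cases e q₂ with ⟨j₂, rfl⟩ | hq₂
  · -- IIII: the all-active block is `qMap γ Γ`
    simp only [qMap_apply, frozenOne_apply_apply e γ hK, frozenTwo_active e γ Γ hK,
      embTwo_mul_mul_active, sum_mixedPair_mul_mul_active_row e _ hV, twoHoleRDM_single,
      OrderEmbedding.eq_iff_eq, apply_mem_union_iff, true_or, if_true, add_zero]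
  · -- III E
    simp only [qMap_apply, frozenOne_env_apply e γ hq₂, frozenTwo_IEII e γ Γ hK _ _ _ hq₂,
      embTwo_mul_mul_env_snd' e _ hq₂, sum_mixedPair_mul_mul_active_row e _ hV, twoHoleRDM_single,
      apply_eq_env_iff e hq₂, apply_mem_union_iff, true_or, if_true, if_false, mul_zero, zero_mul,
      add_zero, sub_self]
  · -- II E I
    simp only [qMap_apply, frozenOne_env_apply e γ hq₁, frozenTwo_EIII e γ Γ hK _ _ _ hq₁,
      embTwo_mul_mul_env_fst' e _ hq₁, sum_mixedPair_mul_mul_active_row e _ hV, twoHoleRDM_single,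
      apply_eq_env_iff e hq₁, apply_mem_union_iff, true_or, if_true, if_false, mul_zero, zero_mul,
      add_zero, sub_self]
  · -- II EE
    simp only [qMap_apply, frozenOne_env_apply e γ hq₁, frozenOne_env_apply e γ hq₂,
      frozenTwo_EEII e γ Γ hK _ _ hq₁ hq₂, embTwo_mul_mul_env_fst' e _ hq₁,
      sum_mixedPair_mul_mul_active_row e _ hV, twoHoleRDM_single, apply_eq_env_iff e hq₁,
      apply_eq_env_iff e hq₂, apply_mem_union_iff, true_or, if_true, if_false, mul_zero, add_zero,
      sub_self]
  · -- I E I I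
    simp only [qMap_apply, frozenOne_apply_env e γ hp₂, frozenTwo_IIIE e γ Γ hK _ _ _ hp₂,
      embTwo_mul_mul_env_snd e _ hp₂, sum_mixedPair_mul_mul_active_col e _ hV, twoHoleRDM_single,
      env_eq_apply_iff e hp₂, apply_mem_union_iff, true_or, if_true, if_false, mul_zero, zero_mul,
      add_zero, sub_self]
  · -- I E I E  (active hole ⊗ virtual hole)
    simp only [qMap_apply, frozenOne_apply_apply e γ hK, frozenOne_env_env e γ hq₂,
      frozenTwo_IEIE e γ Γ hK _ _ hq₂, embTwo_mul_mul_env_snd e _ hp₂,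
      sum_mixedPair_mul_mul_IEIE e _ hV, twoHoleRDM_single, env_eq_apply_iff e hp₂,
      apply_eq_env_iff e hq₂, env_mem_compl_union_iff e K hq₂, OrderEmbedding.eq_iff_eq,
      apply_mem_union_iff, true_or, if_true, if_false, mul_zero, zero_mul, sub_zero, zero_add,
      add_zero, Matrix.sub_apply, Matrix.one_apply, Matrix.transpose_apply]
    by_cases h₁ : i₁ = j₁ <;> by_cases h₂ : p₂ = q₂ <;> by_cases h₃ : p₂ ∈ K <;> by_cases h₄ : q₂ ∈ K <;>
      simp_all [eq_comm]
  · -- I E E I  (exchange pattern)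
    simp only [qMap_apply, frozenOne_apply_apply e γ hK, frozenOne_env_env e γ hq₁,
      frozenTwo_EIIE e γ Γ hK _ _ hq₁, embTwo_mul_mul_env_snd e _ hp₂,
      sum_mixedPair_mul_mul_IEEI e _ hV, twoHoleRDM_single, env_eq_apply_iff e hp₂,
      apply_eq_env_iff e hq₁, env_mem_compl_union_iff e K hq₁, OrderEmbedding.eq_iff_eq,
      apply_mem_union_iff, true_or, if_true, if_false, mul_zero, zero_mul, sub_zero, zero_sub,
      zero_add, add_zero, Matrix.sub_apply, Matrix.one_apply, Matrix.transpose_apply]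
    by_cases h₁ : i₁ = j₂ <;> by_cases h₂ : p₂ = q₁ <;> by_cases h₃ : p₂ ∈ K <;> by_cases h₄ : q₁ ∈ K <;>
      simp_all [eq_comm]
    ring
  · -- I E E E
    simp only [qMap_apply, frozenOne_env_apply e γ hq₁, frozenOne_env_apply e γ hq₂,
      frozenTwo_EEIE e γ Γ hK _ hq₁ hq₂, embTwo_mul_mul_env_fst' e _ hq₁,
      sum_mixedPair_mul_mul_env_col e _ _ hq₁ hq₂, twoHoleRDM_single, apply_eq_env_iff e hq₁,
      apply_eq_env_iff e hq₂, apply_mem_union_iff, true_or, if_true, if_false, mul_zero, zero_mul,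
      add_zero, sub_self]
  · -- E I I I
    simp only [qMap_apply, frozenOne_apply_env e γ hp₁, frozenTwo_IIEI e γ Γ hK _ _ _ hp₁,
      embTwo_mul_mul_env_fst e _ hp₁, sum_mixedPair_mul_mul_active_col e _ hV, twoHoleRDM_single,
      env_eq_apply_iff e hp₁, apply_mem_union_iff, or_true, if_true, if_false, mul_zero, zero_mul,
      add_zero, sub_self]
  · -- E I I E  (exchange pattern)
    simp only [qMap_apply, frozenOne_apply_apply e γ hK, frozenOne_env_env e γ hq₂,
      frozenTwo_IEEI e γ Γ hK _ _ hq₂, embTwo_mul_mul_env_fst e _ hp₁,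
      sum_mixedPair_mul_mul_EIIE e _ hV, twoHoleRDM_single, env_eq_apply_iff e hp₁,
      apply_eq_env_iff e hq₂, env_mem_compl_union_iff e K hq₂, OrderEmbedding.eq_iff_eq,
      apply_mem_union_iff, or_true, if_true, if_false, mul_zero, zero_mul, sub_zero, zero_sub,
      zero_add, add_zero, Matrix.sub_apply, Matrix.one_apply, Matrix.transpose_apply]
    by_cases h₁ : i₂ = j₁ <;> by_cases h₂ : p₁ = q₂ <;> by_cases h₃ : p₁ ∈ K <;> by_cases h₄ : q₂ ∈ K <;>
      simp_all [eq_comm]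
    ring
  · -- E I E I  (core/virtual occupied slot pattern)
    simp only [qMap_apply, frozenOne_apply_apply e γ hK, frozenOne_env_env e γ hq₁,
      frozenTwo_EIEI e γ Γ hK _ _ hq₁, embTwo_mul_mul_env_fst e _ hp₁,
      sum_mixedPair_mul_mul_EIEI e _ hV, twoHoleRDM_single, env_eq_apply_iff e hp₁,
      apply_eq_env_iff e hq₁, env_mem_compl_union_iff e K hq₁, OrderEmbedding.eq_iff_eq,
      apply_mem_union_iff, or_true, if_true, if_false, mul_zero, zero_mul, sub_zero, zero_add,
      add_zero, Matrix.sub_apply, Matrix.one_apply, Matrix.transpose_apply]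
    by_cases h₁ : i₂ = j₂ <;> by_cases h₂ : p₁ = q₁ <;> by_cases h₃ : p₁ ∈ K <;> by_cases h₄ : q₁ ∈ K <;>
      simp_all [eq_comm]
  · -- E I E E
    simp only [qMap_apply, frozenOne_env_apply e γ hq₁, frozenOne_env_apply e γ hq₂,
      frozenTwo_EEEI e γ Γ hK _ hq₁ hq₂, embTwo_mul_mul_env_fst' e _ hq₁,
      sum_mixedPair_mul_mul_env_col e _ _ hq₁ hq₂, twoHoleRDM_single, apply_eq_env_iff e hq₁,
      apply_eq_env_iff e hq₂, apply_mem_union_iff, or_true, if_true, if_false, mul_zero, zero_mul,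
      add_zero, sub_self]
  · -- E E I I
    simp only [qMap_apply, frozenOne_apply_env e γ hp₁, frozenOne_apply_env e γ hp₂,
      frozenTwo_IIEE e γ Γ hK _ _ hp₁ hp₂, embTwo_mul_mul_env_fst e _ hp₁,
      sum_mixedPair_mul_mul_env_row e _ _ hp₁ hp₂, twoHoleRDM_single, env_eq_apply_iff e hp₁,
      env_eq_apply_iff e hp₂, if_false, mul_zero, add_zero, sub_self, ite_self]
  · -- E E I E
    simp only [qMap_apply, frozenOne_apply_env e γ hp₁, frozenOne_apply_env e γ hp₂,
      frozenTwo_IEEE e γ Γ _ hp₁ hq₂ hp₂, embTwo_mul_mul_env_fst e _ hp₁,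
      sum_mixedPair_mul_mul_env_row e _ _ hp₁ hp₂, twoHoleRDM_single, env_eq_apply_iff e hp₁,
      env_eq_apply_iff e hp₂, if_false, mul_zero, zero_mul, add_zero, sub_self, ite_self]
  · -- E E E I
    simp only [qMap_apply, frozenOne_apply_env e γ hp₁, frozenOne_apply_env e γ hp₂,
      frozenTwo_EIEE e γ Γ _ hq₁ hp₁ hp₂, embTwo_mul_mul_env_fst e _ hp₁,
      sum_mixedPair_mul_mul_env_row e _ _ hp₁ hp₂, twoHoleRDM_single, env_eq_apply_iff e hp₁,
      env_eq_apply_iff e hp₂, if_false, mul_zero, zero_mul, add_zero, sub_self, ite_self]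
  · -- E E E E: the virtual two-hole block is the two-hole matrix of `|K⟩` on environment indices
    rw [embTwo_mul_mul_env_fst e _ hp₁, sum_mixedPair_mul_mul_env_row e _ _ hp₁ hp₂, zero_add, zero_add,
      twoHoleRDM_single]
    simp only [env_mem_union_iff e K hp₁, env_mem_union_iff e K hp₂]
    rw [← twoHoleRDM_single K p₁ p₂ q₁ q₂, twoHoleRDM_apply, qMap_apply, star_single_dotProduct_single,
      mul_one, oneRDM_single, oneRDM_single, oneRDM_single, oneRDM_single, twoRDM_single]
    simp only [frozenOne_env_env e γ hq₁, frozenOne_env_env e γ hq₂, frozenTwo_env e γ Γ hq₁ hq₂]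

/-- **THE `Q`-CONDITION TRANSPORTS ALONG THE FROZEN-CORE EXTENSION**: if `qMap γ Γ ⪰ 0` and the
one-hole matrix `1 − γᵀ ⪰ 0`, then `qMap γ' Γ' ⪰ 0`. -/
theorem posSemidef_qMap_frozen (hK : Disjoint K (rangeF e)) (hQ : (qMap γ Γ).PosSemidef)
    (h1 : (1 - γᵀ).PosSemidef) : (qMap (frozenOne e K γ) (frozenTwo e K γ Γ)).PosSemidef := by
  rw [qMap_frozen e γ Γ hK]
  exact ((hQ.mul_mul_conjTranspose_same (embTwo e)).add
    (posSemidef_sum _ fun v _ => h1.mul_mul_conjTranspose_same (mixedPair e v))).add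
    (twoHoleRDM_posSemidef _)

/-- The `Q`-condition of the extension of a DQG-feasible pair with at least two empty active spin
orbitals (`N + 2 ≤ |ι|`, where `IsDQGFeasible.oneHole_posSemidef` gives `1 − γᵀ ⪰ 0`). -/
theorem posSemidef_qMap_frozen_of_isDQGFeasible (hK : Disjoint K (rangeF e)) {N : ℕ}
    (h : IsDQGFeasible N γ Γ) (hr : N + 2 ≤ Fintype.card ι) :
    (qMap (frozenOne e K γ) (frozenTwo e K γ Γ)).PosSemidef :=
  posSemidef_qMap_frozen e γ Γ hK h.q_psd (h.oneHole_posSemidef hr)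

end Hole

end Summit.Ventures.CertifiedQuantumChemistry

end
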